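import Summits.Parity.GeneralizedHardyLittlewood.Theorems.PrimeLevelFamEdgeMomentsBeyondDiagonalFirstOrderDiagMainCoeff
import HarnessLib

/-!
# The order-`i` diagonal sum: `Σ_{m ≤ M} μ(m)ψ(m)⁻¹m⁻¹ P(log(M/m)/log M)(log(M/m) − θ log M)^i = ζ(2)(log M)^{i−1}(P′(1)(1−θ)^i + iP(1)(1−θ)^{i−1}) + O((log M)^{i−2})`
# (helper for crux K_A `PrimeLevelFamEdge.MomentsBeyondDiagonal`, stmt-Parity-20007, stub `stub_first : SubFirst` ∀`Q`)

KMV §4.1 (19)–(20) at order `i`, in real variables: for an admissible profile `P` (`P(0) = P′(0) = 0`), a real `θ` and `i`,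
there is `C` with, for all `M ≥ 3` (`Lg = log M`),
`|Lg² · Σ_{m ≤ M} μ(m)ψ(m)⁻¹m⁻¹ P(log(M/m)/Lg)(log(M/m) − θLg)^i − ζ(2) Lg^{i+1} (P′(1)(1−θ)^i + i P(1)(1−θ)^{i−1})| ≤ C Lg^i`
(`diagSum_mul_sq_log_sub_le`; stated after multiplication by `Lg²` so that all exponents are natural). Ingredients:
`diagSum_expand` (binomial re-expansion onto `W_{b+c}(M)`), the tree's `MollifierMainTerm.abs_weightLogPowSum_sub_le`
(`W_j(M) = ζ(2) j Lg^{j−1} + O(Lg^{j−2})`, `j ≥ 2`; admissibility gives `c ≥ 2`), and `sum_coeff_choose_mul_add_eq`.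
With `θ = (Δ'−1)/Δ'`, `M = q̂^{Δ'}` this is the diagonal main term `ζ(2)ℓ^{i−1}(P′(1)/Δ' + iP(1))` of the order-`i` mollified first
moment. Proof only; nothing about Landau–Siegel zeros; K_A NOT proved.
-/

noncomputable section

open scoped Real ArithmeticFunction.Moebius
open Finset Polynomial ArithmeticFunction
open Literature.NumberTheory.LFunctions Literature.NumberTheory.LFunctions.KMV2000
open Literature.NumberTheory.LFunctions.KMV2000.MollifierMainTerm

namespace Summit.Parity.GeneralizedHardyLittlewood.Theorems.MomentsBeyondDiagonal.FirstOrderAFE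

/-- Admissible profiles have `P_0 = P_1 = 0`. -/
theorem coeff_eq_zero_of_admissible {P : ℝ[X]} (hP : Admissible P) {c : ℕ} (hc : c < 2) : P.coeff c = 0 := by
  obtain ⟨h0, h1⟩ := hP
  interval_cases c
  · rwa [← Polynomial.coeff_zero_eq_eval_zero] at h0
  · rwa [Polynomial.derivative_eval, Polynomial.sum, Finset.sum_eq_single 1, pow_zero, mul_one, Nat.cast_one,
      mul_one] at h1
    · intro b _ hb
      rcases Nat.eq_zero_or_pos b with rfl | hb0
      · simp
      · have : b - 1 ≠ 0 := by omega
        simp [zero_pow this]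
    · intro h
      simp only [Polynomial.mem_support_iff, ne_eq, not_not] at h
      simp [h]

set_option maxHeartbeats 400000 in
/-- **The order-`i` diagonal sum** (KMV §4.1 (19)–(20) at order `i`): for admissible `P`, real `θ` and `i` there is `C` with
`|Lg²·D_i(M) − ζ(2)Lg^{i+1}(P′(1)(1−θ)^i + iP(1)(1−θ)^{i−1})| ≤ CLg^i` for all `M ≥ 3`, `Lg = log M`,
`D_i(M) = Σ_{m ≤ M} μ(m)ψ(m)⁻¹m⁻¹ P(log(M/m)/Lg)(log(M/m) − θLg)^i`. [cite: KowalskiMichelVanderKam2000, §4.1 (19)–(20)] -/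
theorem diagSum_mul_sq_log_sub_le {P : ℝ[X]} (hP : Admissible P) (θ : ℝ) (i : ℕ) :
    ∃ C : ℝ, ∀ M : ℝ, 3 ≤ M →
      |Real.log M ^ 2 * ∑ m ∈ Icc 1 ⌊M⌋₊, (μ m : ℝ) * ((psi m)⁻¹ * (m : ℝ)⁻¹) *
            P.eval (Real.log (M / m) / Real.log M) * (Real.log (M / m) - θ * Real.log M) ^ i -
          π ^ 2 / 6 * Real.log M ^ (i + 1) *
            ((derivative P).eval 1 * (1 - θ) ^ i + (i : ℝ) * P.eval 1 * (1 - θ) ^ (i - 1))| ≤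
        C * Real.log M ^ i := by
  classical
  -- constants for the `W_j` asymptotics, `j ≥ 2`
  have hC : ∀ j : ℕ, ∃ C : ℝ, 0 ≤ C ∧ (2 ≤ j → ∀ M : ℝ, 3 ≤ M →
      |weightLogPowSum j M - π ^ 2 / 6 * j * Real.log M ^ (j - 1)| ≤ C * Real.log M ^ (j - 2)) := by
    intro j
    by_cases hj : 2 ≤ j
    · obtain ⟨C, hC⟩ := abs_weightLogPowSum_sub_le hj
      exact ⟨max C 0, le_max_right _ _, fun _ M hM ↦ (hC M hM).trans
        (mul_le_mul_of_nonneg_right (le_max_left _ _) (pow_nonneg (Real.log_nonneg (by linarith)) _))⟩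
    · exact ⟨0, le_rfl, fun h ↦ absurd h hj⟩
  choose Cf hCf0 hCf using hC
  -- the constant
  refine ⟨∑ c ∈ range (P.natDegree + 1), ∑ b ∈ range (i + 1),
      |P.coeff c| * ((i.choose b : ℕ) : ℝ) * |θ| ^ (i - b) * Cf (b + c), fun M hM ↦ ?_⟩
  set Lg : ℝ := Real.log M with hLg
  have hLg1 : 1 < Lg := by
    rw [hLg, Real.lt_log_iff_exp_lt (by linarith)]
    exact lt_of_lt_of_le (by have := Real.exp_one_lt_d9; norm_num at this; linarith) hM
  have hLg0 : 0 < Lg := by linarith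
  have hLgne : Lg ≠ 0 := hLg0.ne'
  -- expand
  rw [diagSum_expand P M (θ * Lg) i, Finset.mul_sum,
    show π ^ 2 / 6 * Lg ^ (i + 1) * ((derivative P).eval 1 * (1 - θ) ^ i + (i : ℝ) * P.eval 1 * (1 - θ) ^ (i - 1)) =
      π ^ 2 / 6 * Lg ^ (i + 1) * ∑ c ∈ range (P.natDegree + 1), ∑ b ∈ range (i + 1),
        P.coeff c * ((i.choose b : ℕ) : ℝ) * (-θ) ^ (i - b) * ((b : ℝ) + c) by rw [sum_coeff_choose_mul_add_eq],
    Finset.mul_sum, ← Finset.sum_sub_distrib]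
  refine (Finset.abs_sum_le_sum_abs _ _).trans ?_
  rw [Finset.sum_mul]
  refine Finset.sum_le_sum fun c hc ↦ ?_
  rw [Finset.mul_sum, Finset.mul_sum, ← Finset.sum_sub_distrib]
  refine (Finset.abs_sum_le_sum_abs _ _).trans ?_
  rw [Finset.sum_mul]
  refine Finset.sum_le_sum fun b hb ↦ ?_
  have hbi : b ≤ i := Nat.lt_succ_iff.mp (Finset.mem_range.mp hb)
  -- the term with `P_c = 0` vanishes
  by_cases hpc : P.coeff c = 0
  · simp [hpc]
  have hc2 : 2 ≤ c := by
    by_contra h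
    exact hpc (coeff_eq_zero_of_admissible hP (by omega))
  have hbc : 2 ≤ b + c := by omega
  have hW := hCf (b + c) hbc M hM
  rw [← hLg] at hW
  -- exponent bookkeeping: `Lg² Lg⁻ᶜ Lg^{i-b} θ'… Lg^{b+c-1} = Lg^{i+1}`, `Lg² Lg⁻ᶜ Lg^{i-b} Lg^{b+c-2} = Lg^i`
  have e1 : Lg ^ 2 * (Lg⁻¹ ^ c * (Lg ^ (i - b) * Lg ^ (b + c - 1))) = Lg ^ (i + 1) := by
    rw [inv_pow, ← zpow_natCast, ← zpow_natCast, ← zpow_natCast, ← zpow_natCast, ← zpow_natCast, ← zpow_neg,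
      ← zpow_add₀ hLgne, ← zpow_add₀ hLgne, ← zpow_add₀ hLgne]
    congr 1
    push_cast [Nat.cast_sub hbi, Nat.cast_sub (by omega : 1 ≤ b + c)]
    ring
  have e2 : Lg ^ 2 * (Lg⁻¹ ^ c * (Lg ^ (i - b) * Lg ^ (b + c - 2))) = Lg ^ i := by
    rw [inv_pow, ← zpow_natCast, ← zpow_natCast, ← zpow_natCast, ← zpow_natCast, ← zpow_natCast, ← zpow_neg,
      ← zpow_add₀ hLgne, ← zpow_add₀ hLgne, ← zpow_add₀ hLgne]
    congr 1
    push_cast [Nat.cast_sub hbi, Nat.cast_sub hbc]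
    ring
  -- the term minus its main part
  have hpow : (-(θ * Lg)) ^ (i - b) = (-θ) ^ (i - b) * Lg ^ (i - b) := by
    rw [show -(θ * Lg) = (-θ) * Lg by ring, mul_pow]
  have hsplit : Lg ^ 2 * (P.coeff c * Lg⁻¹ ^ c * ((i.choose b : ℕ) : ℝ) * (-(θ * Lg)) ^ (i - b) * weightLogPowSum (b + c) M) -
      π ^ 2 / 6 * Lg ^ (i + 1) * (P.coeff c * ((i.choose b : ℕ) : ℝ) * (-θ) ^ (i - b) * ((b : ℝ) + c)) =
      P.coeff c * ((i.choose b : ℕ) : ℝ) * (-θ) ^ (i - b) * (Lg ^ 2 * (Lg⁻¹ ^ c * Lg ^ (i - b))) *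
        (weightLogPowSum (b + c) M - π ^ 2 / 6 * ((b + c : ℕ) : ℝ) * Lg ^ (b + c - 1)) := by
    rw [← e1, hpow]
    push_cast
    ring
  have hfac : 0 < Lg ^ 2 * (Lg⁻¹ ^ c * Lg ^ (i - b)) := by positivity
  rw [hsplit]
  simp only [abs_mul, abs_pow, abs_neg, Nat.abs_cast, abs_of_pos hfac]
  calc |P.coeff c| * ((i.choose b : ℕ) : ℝ) * |θ| ^ (i - b) * (Lg ^ 2 * (Lg⁻¹ ^ c * Lg ^ (i - b))) *
        |weightLogPowSum (b + c) M - π ^ 2 / 6 * ((b + c : ℕ) : ℝ) * Lg ^ (b + c - 1)|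
      ≤ |P.coeff c| * ((i.choose b : ℕ) : ℝ) * |θ| ^ (i - b) * (Lg ^ 2 * (Lg⁻¹ ^ c * Lg ^ (i - b))) *
          (Cf (b + c) * Lg ^ (b + c - 2)) := by gcongr
    _ = |P.coeff c| * ((i.choose b : ℕ) : ℝ) * |θ| ^ (i - b) * Cf (b + c) *
          (Lg ^ 2 * (Lg⁻¹ ^ c * (Lg ^ (i - b) * Lg ^ (b + c - 2)))) := by ring
    _ = |P.coeff c| * ((i.choose b : ℕ) : ℝ) * |θ| ^ (i - b) * Cf (b + c) * Lg ^ i := by rw [e2]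

end Summit.Parity.GeneralizedHardyLittlewood.Theorems.MomentsBeyondDiagonal.FirstOrderAFE

end
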